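import Mathlib
import Literature.AlgebraicGeometry.Resolution.PlaneGermNonNCCount
import Literature.AlgebraicGeometry.Resolution.PlaneGermBlowup

/-!
# The count of non-normal-crossing infinitely near points only sees the support

Companion of `PlaneGermNonNCCount` (strong embedded resolution of plane curve germs in chart form: Hartshorne,
*Algebraic Geometry* V.3.9; Campillo, LNM 813, Ch. III; Casas-Alvero §§3.7–3.8; Lipman, Ann. Math. 107 (1978) §2).
The classical count `ν(b)` of infinitely near points of the origin at which the reduced total transform of the
curve `b = 0` is not a normal crossing is, by its very definition, a function of the SUPPORT of `b` (the reduced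
curve `b_red = 0`).  The tree's `PlaneGermNonNCCount` records only monotonicity under divisibility
(`b ∣ d → ν b ≤ ν d`); the users of the count for MARKED coefficient ideals (the tuple game of
`CobordantTupleGame.lean`, where exceptional coordinates accumulate with arbitrary exponents) need the radical
form `b ∣ d^N → ν b ≤ ν d` (inclusion of supports), which this file states as the named fact
`PlaneGermNonNCCountRad` — otherwise verbatim the three clauses of `PlaneGermNonNCCount`, with
`PlaneGerm.IsNC` for the normal-crossing clause.

Deliberately NOT here: the proof (the longest-bad-chain count of
`Summits/…/Theorems/WeightedInvariantLocalWeightedDropNonNCCountAssembly.lean` lifts chains along `b ∣ d^N`: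
a first-neighbourhood germ of `b` divides a power of the corresponding one of `d`), filed Summits-side as a stub of
the crux `LocalWeightedDrop`; and unique factorisation in `k[[x,y]]`, which would make "support" literal.
-/

namespace Literature.AlgebraicGeometry.Resolution

/-- **Named fact (the non-normal-crossing count is radical-monotone).**  Over a field `k` there is
`ν : k[[y₀,y₁]] → ℕ` — the number of infinitely near points of the origin, origin included, at which the reduced total
transform of `b = 0` under the chain of point blow-ups is not a normal crossing — such that for non-zero germs:
(i) `ν b = 0 ↔ PlaneGerm.IsNC b` (normal-crossing support);
(ii) RADICAL MONOTONICITY `b ∣ d^{N+1}`, `d ≠ 0` `→ ν b ≤ ν d` (the support of `b` is contained in that of `d`);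
(iii) if the support of `b` is not a normal crossing then at every exceptional point `c ≠ 0` of the point blow-up
(`b(s(c + y')) = sᵃ·G`, `s ∤ G`) some slot `i` with `cᵢ ≠ 0` has `ν (s · G|_{y_i' = 0}) < ν b`.
The count is a function of the reduced curve by definition, so (ii) is part of the classical statement; finiteness
is Hartshorne, *Algebraic Geometry*, Thm. V.3.9 (any characteristic), Casas-Alvero Thm. 3.7.1 / Lemma 3.8.1 for
formal germs. [cite: Hartshorne1977, Thm. V.3.9]
-- TODO(general form): as for `PlaneGermNonNCCount` (curves on a regular surface; the full resolution
-- configuration); here only the support-level count with radical monotonicity. -/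
def PlaneGermNonNCCountRad (k : Type*) [Field k] : Prop :=
    ∃ ν : MvPowerSeries (Fin 2) k → ℕ,
      (∀ b : MvPowerSeries (Fin 2) k, b ≠ 0 → (ν b = 0 ↔ PlaneGerm.IsNC b)) ∧
      (∀ b d : MvPowerSeries (Fin 2) k, d ≠ 0 → ∀ N : ℕ, b ∣ d ^ (N + 1) → ν b ≤ ν d) ∧
      (∀ b : MvPowerSeries (Fin 2) k, b ≠ 0 → ¬ PlaneGerm.IsNC b →
        ∀ c : Fin 2 → k, c ≠ 0 → ∀ (a : ℕ) (G : MvPowerSeries (Fin 3) k),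
          MvPowerSeries.subst (CobordantChart.chart (fun _ : Fin 2 => 1) c) b = MvPowerSeries.X 0 ^ a * G →
          ¬ (MvPowerSeries.X (0 : Fin 3) ∣ G) →
          ∃ i : Fin 2, c i ≠ 0 ∧
            ν (MvPowerSeries.X 0 * MvPowerSeries.subst (fun j : Fin 3 => if j = i.succ then (0 : MvPowerSeries (Fin 2) k)
                  else MvPowerSeries.X (Fin.predAbove i j)) G) < ν b)

/-- The radical form implies the tree's `PlaneGermNonNCCount` (take `N = 0` in (ii); (i)/(iii) are the same clauses
with `PlaneGerm.IsNC` unfolded). [folklore] -/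
theorem PlaneGermNonNCCountRad.planeGermNonNCCount {k : Type*} [Field k] (h : PlaneGermNonNCCountRad k) :
    PlaneGermNonNCCount k := by
  obtain ⟨ν, h1, h2, h3⟩ := h
  refine ⟨ν, fun b hb => ?_, fun b d hd hbd => h2 b d hd 0 (by rwa [zero_add, pow_one]), fun b hb hnc => ?_⟩
  · rw [h1 b hb, PlaneGerm.isNC_iff]
  · exact h3 b hb (by rwa [PlaneGerm.isNC_iff])

end Literature.AlgebraicGeometry.Resolution
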